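import Literature.AnabelianGeometry.EtaleTheta.Discharge.Sec5OfThetaSetting
import Mathlib.FieldTheory.Galois.Infinite

/-!
# [EtTh] Lemma 5.8's «`Y` geometrically connected over `K`» step (`hgc`, GAP G-L2t4-4) at the §5 data OF THE SETTING, from the
# units-in-`ℚ̄_p` dictionary and the GALOIS CORRESPONDENCE `ℚ̄_p^{G_K} = K` (Lem 5.8 proof p.331 / PDF p.105; Def 3.6 (iii)(iv) pp.303–304)

Mochizuki, *The étale theta function …*, Publ. RIMS **45** (2009), Lemma 5.8 proof p.331 (PDF p.105): "since `Y` is geometrically connected over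
`K`, it follows immediately that the set of elements of `O^×(B_N)` that normalize … is equal to the set of elements on which `Π^tp_Y` [i.e., `G_K`,
via the natural surjection `Π^tp_Y ↠ G_K`] acts via …"; Def. 3.6 (iv) p.304 (PDF p.78): "`C^{bs-fld}` is a `p`-adic Frobenioid in the sense of [FrdII]
Example 1.1 (ii)" (the units of a Frobenius-trivial object are the units of its base field inside `K̄`); Thm. 3.7 (iii) p.305 (PDF p.79): "the
natural action of `Aut_C(A)` on `O^×(A)` factors through `Aut_{D^cnst}(A^cnst)`".
[cite: MochizukiEtTh2009, Lem 5.8 proof p.331 (PDF p.105); Def 3.6 (iv) p.304 (PDF p.78); Thm 3.7 (iii) p.305 (PDF p.79)]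

abc-iut cell, layer L2, seat abc-iut-L2-t4 (§5 owner, gen 4), ROW W3-L2-01, GAP-LEDGER row **G-L2t4-4** (`hgc`); PROOF-ONLY (no definition, no
named fact; nothing landed is edited).  gen 3 isolated Lemma 5.8's geometric-connectedness step as the binder
  `hgc : ∀ u ∈ O^×(B_N), (∀ y ∈ Im(Π^tp_Y), s^⊓-gp_N(y) · u · s^⊓-gp_N(y)⁻¹ = u) → (u ↦ O^×(B_N^birat)) ∈ Im(K^× ↪ O^×(B_N^birat))`
of `facts_ofConnectedTemperoid(Ydd)Data` («the `Π^tp_Y`-invariant units of `B_N` are constants»).  AT THE SETTING (`ofThetaSettingData`, p433549) this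
file REDUCES it to the base-field dictionary in the SAME «constants read in `ℚ̄_p`» shape as abc-iut-L2-t11's ν-family (v-next census 10:18Z) —
  `ν₀ : O^×(B_N) →* ℚ̄_p^×` («a unit of `B_N` is a unit of the base field `L_{B_N} ⊆ ℚ̄_p`», Def. 3.6 (iv)),
  `hgal` : `u' = s^⊓-gp_N(ρ_N k) · u · s^⊓-gp_N(ρ_N k)⁻¹ ⇒ ν₀(u') = aug(k) · ν₀(u)` for `k ∈ Π^tp_X̲̲` (Thm. 3.7 (iii): the action on units is
  Galois; same shape as `CyclotomicCharacterCompat`),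
  `hKc` : a unit whose value lies in `K` is the image of a constant of `K^×` (Def. 3.6 (iii): `K^× ↪ O^×(B_N^birat)` are THE constants),
— plus ONE piece of genuine Galois theory PROVED here: **`ℚ̄_p^{G_K} = K`** (infinite Galois correspondence, Mathlib
`InfiniteGalois.fixedField_fixingSubgroup`) and «`Π^tp_Ÿ̲̲ ↠ G_K`» (t8's `map_aug_Ydduu`): a `Π^tp_Y`-invariant unit has `G_K`-invariant value,
hence value in `K`, hence is a constant.  RESULTS: `mem_K_of_forall_GK_apply_eq` (Galois correspondence on `ℚ̄_p/K`),
`exists_PiY_aug_eq` (every `σ ∈ G_K` is `aug(k)` for some `k ∈ Π^tp_Ÿ̲̲ ⊆ Π^tp_Y̲̲`), **`hgc_ofThetaSettingData_of_unitsDictionary`** (the binder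
`hgc` VERBATIM), and **`facts_ofThetaSettingYddData_of_unitsDictionary`** (`Facts` of the §5 data of the Setting ⟸ {`hconst`, ν₀-dictionary}).
HONEST FRAMING: kernel-checked reduction; the dictionary (`ν₀`, `hgal`, `hKc`) stays a hypothesis about the abstract tempered Frobenioid `tf`
(print's Def 3.6 (iii)/(iv) content, not in the tree for a curve); nothing of [EtTh] is asserted unconditionally; no side taken on [IUTchIII] Cor. 3.12;
typed ≠ proved.
-/

noncomputable section

namespace Literature.AnabelianGeometry.EtaleTheta

open CategoryTheory Opposite Literature.AlgebraicGeometry.Frobenioids Literature.AnabelianGeometry.SemiGraphs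
  Literature.AnabelianGeometry.SemiGraphs.GaloisObjects Literature.AlgebraicGeometry.Frobenioids.QuasiTemperoid.BTempConnected

universe v₀

/-! ### Galois correspondence on `ℚ̄_p / K` and «`Π^tp_Ÿ̲̲ ↠ G_K`» -/

namespace ThetaSetting

variable {p : ℕ} [Fact p.Prime] (D : ThetaSetting p)

/-- **`ℚ̄_p^{G_K} = K`**: an element of `ℚ̄_p` fixed by every `σ ∈ G_K = Gal(ℚ̄_p/K)` lies in `K` (infinite Galois correspondence; `ℚ̄_p/ℚ_p`
is Galois).  [cite: NeukirchANT1999, Ch. IV §1 Thm. (1.2)] -/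
theorem mem_K_of_forall_GK_apply_eq (x : PadicAlgCl p) (hx : ∀ σ ∈ D.GK, σ x = x) : x ∈ D.K := by
  haveI : IsGalois ℚ_[p] (PadicAlgCl p) := {}
  have hmem : x ∈ IntermediateField.fixedField D.K.fixingSubgroup := by
    rw [IntermediateField.mem_fixedField_iff]
    intro σ hσ
    exact hx σ hσ
  rwa [InfiniteGalois.fixedField_fixingSubgroup] at hmem

namespace EtaleThetaData.DoubleUnderline

variable {D} {E : D.EtaleThetaData} {l : ℕ} (C : E.DoubleUnderline l) {N : ℕ+} (μ : D.CyclotomeMod l N) (hC : D.Compat)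
  (hS : D.Sec2Hyps)

/-- **«`Π^tp_Ÿ̲̲ ↠ G_K`» read in the §2 datum**: every `σ ∈ G_K` is `aug(k)` for some `k ∈ Π^tp_X̲̲` lying in `T.PiYdd` (hence in `T.PiY`), for
`T := C.thetaEnvData μ hC hS` (t8's field `map_aug_Ydduu`: `Ÿ̲̲` geometrically connected over `K`).  [cite: MochizukiEtTh2009, §5 p.322 (PDF p.96)] -/
theorem exists_PiYdd_aug_eq (σ : GQp p) (hσ : σ ∈ D.GK) :
    ∃ k : C.Huu, k ∈ (C.thetaEnvData μ hC hS).PiYdd ∧ D.aug (k : D.PiTemp) = σ := by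
  have hσ' : σ ∈ (D.GtpYdd ⊓ C.Huu).map D.aug.toMonoidHom := by rw [C.map_aug_Ydduu]; exact hσ
  obtain ⟨g, hg, hgσ⟩ := hσ'
  exact ⟨⟨g, hg.2⟩, Subgroup.mem_subgroupOf.2 hg.1, hgσ⟩

/-- The same with `k ∈ T.PiY` (`Π^tp_Ÿ̲̲ ⊆ Π^tp_Y̲̲`). [cite: MochizukiEtTh2009, §5 p.322 (PDF p.96)] -/
theorem exists_PiY_aug_eq (σ : GQp p) (hσ : σ ∈ D.GK) :
    ∃ k : C.Huu, k ∈ (C.thetaEnvData μ hC hS).PiY ∧ D.aug (k : D.PiTemp) = σ := by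
  obtain ⟨k, hk, hkσ⟩ := C.exists_PiYdd_aug_eq μ hC hS σ hσ
  exact ⟨k, (C.thetaEnvData μ hC hS).PiYdd_le hk, hkσ⟩

end EtaleThetaData.DoubleUnderline

end ThetaSetting

/-! ### `hgc` at the §5 data of the Setting from the units dictionary -/

namespace ThetaFrobenioid

variable {p : ℕ} [Fact p.Prime] {D : ThetaSetting p} {E : D.EtaleThetaData} {l : ℕ} {C : E.DoubleUnderline l}
  {e : D.toTemperedCurve.GroupLevelData} {N : ℕ+} (μ : D.CyclotomeMod l N) (hC : D.Compat) (hS : D.Sec2Hyps)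
  {D₀ : Type} [Category.{v₀} D₀] {V : FrdIMonoidStub.{0}} {T₀ : RealifiedDivisorMonoids (D₀ := D₀) V}
  {VD : FrdICatStub.{1, 0, 0} (ConnectedPart (BTemp (C.temperedArithmeticGroup e).Pi))}
  {tf : TemperedFrobenioid T₀ (ConnectedPart (BTemp (C.temperedArithmeticGroup e).Pi)) VD} {hZ : tf.monoidType = MonoidType.Z}
  {hP : ∀ A : (ConnectedPart (BTemp (C.temperedArithmeticGroup e).Pi))ᵒᵖ, IsPerfect (tf.Φ.carrier A)}
  {NH : Subgroup (Field.absoluteGaloisGroup D.K) → tf.category → ℕ+ → Prop} {A₀ : tf.category}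
  {hA₀ : PreFrobenioid.IsFrobeniusTrivial tf.toElem A₀} {hA₀' : SemiGraphs.IsGaloisObj A₀.base.obj}
  {pullFrac : ∀ {A A' : (BiKummerSetting.mkOfConnectedTemperoid (C.temperedArithmeticGroup e) tf hZ hP NH A₀ hA₀ hA₀').C} (_ : A' ⟶ A),
    (BiKummerSetting.mkOfConnectedTemperoid (C.temperedArithmeticGroup e) tf hZ hP NH A₀ hA₀ hA₀').biratUnits A →
      (BiKummerSetting.mkOfConnectedTemperoid (C.temperedArithmeticGroup e) tf hZ hP NH A₀ hA₀ hA₀').biratUnits A'}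
  {θ : (BiKummerSetting.mkOfConnectedTemperoid (C.temperedArithmeticGroup e) tf hZ hP NH A₀ hA₀ hA₀').biratUnits
    (BiKummerSetting.mkOfConnectedTemperoid (C.temperedArithmeticGroup e) tf hZ hP NH A₀ hA₀ hA₀').Aodot}
  {Bl : (BiKummerSetting.mkOfConnectedTemperoid (C.temperedArithmeticGroup e) tf hZ hP NH A₀ hA₀ hA₀').C}
  {Pl : (BiKummerSetting.mkOfConnectedTemperoid (C.temperedArithmeticGroup e) tf hZ hP NH A₀ hA₀ hA₀').FractionPair θ Bl}
  {Rl : (BiKummerSetting.mkOfConnectedTemperoid (C.temperedArithmeticGroup e) tf hZ hP NH A₀ hA₀ hA₀').NthRoot θ Pl C.lPNat pullFrac}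
  (h : ModelFrobenioid.Hypotheses tf.divisorMonoid tf.ratFnFunctor)
  (Q : FrobenioidTheta.ThetaSubquotientStub.{0} (ConnectedPart (BTemp (C.temperedArithmeticGroup e).Pi)))
  (R : (BiKummerSetting.mkOfConnectedTemperoid (C.temperedArithmeticGroup e) tf hZ hP NH A₀ hA₀ hA₀').NthRoot Rl.root Rl.pair N pullFrac)
  (K' : Type) [Field K'] (constEmb : K'ˣ →* tf.biratUnitsModel R.BN) (constEmb_injective : Function.Injective constEmb)
  (hinvc : ∀ g : Aut R.AN.base,
    pull tf.divisorMonoid g.hom (ModelFrobenioid.div R.pair.num) = ModelFrobenioid.div R.pair.num)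
  (hinvp : ∀ y : (C.thetaEnvData μ hC hS).PiX, y ∈ (C.thetaEnvData μ hC hS).PiYdd →
    pull tf.divisorMonoid ((BiKummerSetting.mkOfConnectedTemperoid (C.temperedArithmeticGroup e) tf hZ hP NH A₀ hA₀ hA₀').galoisSurj
      R.AN.base R.αData.isGalois ((ContinuousMulEquiv.refl _) y)).hom (ModelFrobenioid.div R.pair.den) = ModelFrobenioid.div R.pair.den)
  -- the units-in-`ℚ̄_p` dictionary (Def 3.6 (iii)/(iv), Thm 3.7 (iii)): HYPOTHESES, quoted above
  (ν₀ : (ofThetaSettingData μ hC hS h Q R K' constEmb constEmb_injective hinvc hinvp).units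
      (ofThetaSettingData μ hC hS h Q R K' constEmb constEmb_injective hinvc hinvp).BN →* (PadicAlgCl p)ˣ)
  (hgal : ∀ (k : C.Huu) (u u' : (ofThetaSettingData μ hC hS h Q R K' constEmb constEmb_injective hinvc hinvp).units
      (ofThetaSettingData μ hC hS h Q R K' constEmb constEmb_injective hinvc hinvp).BN),
    (u' : Aut (ofThetaSettingData μ hC hS h Q R K' constEmb constEmb_injective hinvc hinvp).BN) =
      (ofThetaSettingData μ hC hS h Q R K' constEmb constEmb_injective hinvc hinvp).sgpCap
          ((ofThetaSettingData μ hC hS h Q R K' constEmb constEmb_injective hinvc hinvp).ρ k) *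
        (u : Aut (ofThetaSettingData μ hC hS h Q R K' constEmb constEmb_injective hinvc hinvp).BN) *
        ((ofThetaSettingData μ hC hS h Q R K' constEmb constEmb_injective hinvc hinvp).sgpCap
          ((ofThetaSettingData μ hC hS h Q R K' constEmb constEmb_injective hinvc hinvp).ρ k))⁻¹ →
    ((ν₀ u' : (PadicAlgCl p)ˣ) : PadicAlgCl p) = (D.aug (k : D.PiTemp)) ((ν₀ u : (PadicAlgCl p)ˣ) : PadicAlgCl p))
  (hKc : ∀ u : (ofThetaSettingData μ hC hS h Q R K' constEmb constEmb_injective hinvc hinvp).units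
      (ofThetaSettingData μ hC hS h Q R K' constEmb constEmb_injective hinvc hinvp).BN,
    ((ν₀ u : (PadicAlgCl p)ˣ) : PadicAlgCl p) ∈ D.K →
      (ofThetaSettingData μ hC hS h Q R K' constEmb constEmb_injective hinvc hinvp).unitsToBirat
          (ofThetaSettingData μ hC hS h Q R K' constEmb constEmb_injective hinvc hinvp).BN u ∈
        (ofThetaSettingData μ hC hS h Q R K' constEmb constEmb_injective hinvc hinvp).constEmb.range)

/-- **`𝔉.PiY = Π^tp_Y̲̲ = Π^tp_Y ∩ Π^tp_X̲̲`** for the §5 data of the Setting, on the nose (rfl bookkeeping used to read gen 3's `imPiY`-shaped binder).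
[cite: MochizukiEtTh2009, §5 p.330 (PDF p.104)] -/
theorem ofThetaSettingData_PiY :
    (ofThetaSettingData μ hC hS h Q R K' constEmb constEmb_injective hinvc hinvp).PiY = (C.thetaEnvData μ hC hS).PiY := by
  rw [ThetaFrobenioid.PiY]
  exact (C.thetaEnvData μ hC hS).ker_zquot

/-- For `k ∈ Π^tp_Y̲̲` (the §2 datum's `T.PiY`), `ρ_N(k) ∈ Im(Π^tp_Y)` of the §5 data of the Setting (bookkeeping through `𝔉.PiY = T.PiY`).
[cite: MochizukiEtTh2009, §5 p.331 (PDF p.105)] -/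
theorem rho_mem_imPiY_ofThetaSettingData (k : C.Huu) (hk : k ∈ (C.thetaEnvData μ hC hS).PiY) :
    (ofThetaSettingData μ hC hS h Q R K' constEmb constEmb_injective hinvc hinvp).ρ k ∈
      (ofThetaSettingData μ hC hS h Q R K' constEmb constEmb_injective hinvc hinvp).imPiY := by
  refine Subgroup.mem_map_of_mem _ ?_
  rw [ofThetaSettingData_PiY]
  exact hk

include hgal hKc in
/-- **`hgc` (GAP G-L2t4-4) at the §5 data of the Setting from the units dictionary**: a unit `u ∈ O^×(B_N)` commuting with
`s^⊓-gp_N(Im Π^tp_Y)` has `G_K`-invariant value `ν₀(u) ∈ ℚ̄_p` (`hgal` + «`Π^tp_Ÿ̲̲ ↠ G_K`»), hence `ν₀(u) ∈ K` (`ℚ̄_p^{G_K} = K`), hence is the image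
of a constant (`hKc`) — Lemma 5.8's "since `Y` is geometrically connected over `K`".  [cite: MochizukiEtTh2009, Lem 5.8 proof p.331 (PDF p.105)] -/
theorem hgc_ofThetaSettingData_of_unitsDictionary :
    ∀ u : (ofThetaSettingData μ hC hS h Q R K' constEmb constEmb_injective hinvc hinvp).units
        (ofThetaSettingData μ hC hS h Q R K' constEmb constEmb_injective hinvc hinvp).BN,
      (∀ y ∈ (ofThetaSettingData μ hC hS h Q R K' constEmb constEmb_injective hinvc hinvp).imPiY,
        (ofThetaSettingData μ hC hS h Q R K' constEmb constEmb_injective hinvc hinvp).sgpCap y *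
          (u : Aut (ofThetaSettingData μ hC hS h Q R K' constEmb constEmb_injective hinvc hinvp).BN) *
          ((ofThetaSettingData μ hC hS h Q R K' constEmb constEmb_injective hinvc hinvp).sgpCap y)⁻¹ = u) →
      (ofThetaSettingData μ hC hS h Q R K' constEmb constEmb_injective hinvc hinvp).unitsToBirat
          (ofThetaSettingData μ hC hS h Q R K' constEmb constEmb_injective hinvc hinvp).BN u ∈
        (ofThetaSettingData μ hC hS h Q R K' constEmb constEmb_injective hinvc hinvp).constEmb.range := by
  intro u hu
  refine hKc u (D.mem_K_of_forall_GK_apply_eq _ fun σ hσ => ?_)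
  have hex := C.exists_PiY_aug_eq μ hC hS σ hσ
  cases hex with
  | intro k hk =>
    have hy := rho_mem_imPiY_ofThetaSettingData μ hC hS h Q R K' constEmb constEmb_injective hinvc hinvp k hk.1
    have hfix := hu _ hy
    rw [← hk.2]
    exact (hgal k u u hfix.symm).symm

/-- **`Facts` for the §5 data of the Setting (`A_⊙^bs := Ÿ̲̲`) from `hconst` and the units dictionary** — `hgc` no longer a separate input.
[cite: MochizukiEtTh2009, §5 p.330–331 (PDF pp.104–105); Lem 5.8 p.331 (PDF p.105)] -/
theorem facts_ofThetaSettingYddData_of_unitsDictionary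
    {pullFrac' : ∀ {A A' : (BiKummerSetting.mkOfThetaSettingYdd C e μ hC hS tf hZ hP NH).C} (_ : A' ⟶ A),
      (BiKummerSetting.mkOfThetaSettingYdd C e μ hC hS tf hZ hP NH).biratUnits A →
        (BiKummerSetting.mkOfThetaSettingYdd C e μ hC hS tf hZ hP NH).biratUnits A'}
    {θ' : (BiKummerSetting.mkOfThetaSettingYdd C e μ hC hS tf hZ hP NH).biratUnits (BiKummerSetting.mkOfThetaSettingYdd C e μ hC hS tf hZ hP NH).Aodot}
    {Bl' : (BiKummerSetting.mkOfThetaSettingYdd C e μ hC hS tf hZ hP NH).C}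
    {Pl' : (BiKummerSetting.mkOfThetaSettingYdd C e μ hC hS tf hZ hP NH).FractionPair θ' Bl'}
    {Rl' : (BiKummerSetting.mkOfThetaSettingYdd C e μ hC hS tf hZ hP NH).NthRoot θ' Pl' C.lPNat pullFrac'}
    (R' : (BiKummerSetting.mkOfThetaSettingYdd C e μ hC hS tf hZ hP NH).NthRoot Rl'.root Rl'.pair N pullFrac')
    (constEmb' : K'ˣ →* tf.biratUnitsModel R'.BN) (constEmb_injective' : Function.Injective constEmb')
    (hinvc' : ∀ g : Aut R'.AN.base,
      pull tf.divisorMonoid g.hom (ModelFrobenioid.div R'.pair.num) = ModelFrobenioid.div R'.pair.num)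
    (hinvp' : ∀ y : (C.thetaEnvData μ hC hS).PiX, y ∈ (C.thetaEnvData μ hC hS).PiYdd →
      pull tf.divisorMonoid ((BiKummerSetting.mkOfThetaSettingYdd C e μ hC hS tf hZ hP NH).galoisSurj
        R'.AN.base R'.αData.isGalois ((ContinuousMulEquiv.refl _) y)).hom (ModelFrobenioid.div R'.pair.den) = ModelFrobenioid.div R'.pair.den)
    (hconst : ∀ (ε : Aut R'.BN) (k : K'ˣ), tf.biratAutModel R'.BN ε (constEmb' k) = constEmb' k)
    (ν₀' : (ofThetaSettingData μ hC hS h Q R' K' constEmb' constEmb_injective' hinvc' hinvp').units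
        (ofThetaSettingData μ hC hS h Q R' K' constEmb' constEmb_injective' hinvc' hinvp').BN →* (PadicAlgCl p)ˣ)
    (hgal' : ∀ (k : C.Huu) (u u' : (ofThetaSettingData μ hC hS h Q R' K' constEmb' constEmb_injective' hinvc' hinvp').units
        (ofThetaSettingData μ hC hS h Q R' K' constEmb' constEmb_injective' hinvc' hinvp').BN),
      (u' : Aut (ofThetaSettingData μ hC hS h Q R' K' constEmb' constEmb_injective' hinvc' hinvp').BN) =
        (ofThetaSettingData μ hC hS h Q R' K' constEmb' constEmb_injective' hinvc' hinvp').sgpCap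
            ((ofThetaSettingData μ hC hS h Q R' K' constEmb' constEmb_injective' hinvc' hinvp').ρ k) *
          (u : Aut (ofThetaSettingData μ hC hS h Q R' K' constEmb' constEmb_injective' hinvc' hinvp').BN) *
          ((ofThetaSettingData μ hC hS h Q R' K' constEmb' constEmb_injective' hinvc' hinvp').sgpCap
            ((ofThetaSettingData μ hC hS h Q R' K' constEmb' constEmb_injective' hinvc' hinvp').ρ k))⁻¹ →
      ((ν₀' u' : (PadicAlgCl p)ˣ) : PadicAlgCl p) = (D.aug (k : D.PiTemp)) ((ν₀' u : (PadicAlgCl p)ˣ) : PadicAlgCl p))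
    (hKc' : ∀ u : (ofThetaSettingData μ hC hS h Q R' K' constEmb' constEmb_injective' hinvc' hinvp').units
        (ofThetaSettingData μ hC hS h Q R' K' constEmb' constEmb_injective' hinvc' hinvp').BN,
      ((ν₀' u : (PadicAlgCl p)ˣ) : PadicAlgCl p) ∈ D.K →
        (ofThetaSettingData μ hC hS h Q R' K' constEmb' constEmb_injective' hinvc' hinvp').unitsToBirat
            (ofThetaSettingData μ hC hS h Q R' K' constEmb' constEmb_injective' hinvc' hinvp').BN u ∈
          (ofThetaSettingData μ hC hS h Q R' K' constEmb' constEmb_injective' hinvc' hinvp').constEmb.range) :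
    (ofThetaSettingData μ hC hS h Q R' K' constEmb' constEmb_injective' hinvc' hinvp').Facts :=
  facts_ofThetaSettingYddData μ hC hS h Q R' K' constEmb' constEmb_injective' hinvc' hinvp' hconst
    (hgc_ofThetaSettingData_of_unitsDictionary μ hC hS h Q R' K' constEmb' constEmb_injective' hinvc' hinvp' ν₀' hgal' hKc')

end ThetaFrobenioid

end Literature.AnabelianGeometry.EtaleTheta

end
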